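import Summits.Ventures.YMGap.RobustBall.FreeBoundaryDecay
import Summits.Ventures.YMGap.RobustBall.UniformLoopCorrelatorDecay
import HarnessLib

/-!
# Venture YMGap, track ROBUST-BALL — WILSON LOOPS WITH FREE BOUNDARY CONDITIONS converge to their infinite-volume values exponentially
# fast in the distance of the loop to the boundary of the region

HONEST FRAMING. WHAT THIS IS: a venture file (cell `pub-ymgap`, track Y2 ROBUST-BALL, seat ds-3, theorems only): the Wilson-loop reading of
`FreeBoundaryDecay.lean` (free-boundary lattice gauge theory `μ^{free}_{Λs,β} = Z⁻¹ e^{−β S_{Λs}} dg_∞`, lit `zdWilsonMeasure`; locality of the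
one state, Föllmer (2.8) with defects) with rb-p1's loop observable `W_γ = Re tr U_γ/N` (`loopTerm N 1 γ`, Lipschitz constant `√N|γ|` on
`≤ |γ|` links):
* ★★ `su2_wilson_loop_free_upTo_oneTwelfth` — `SU(2)` on `ℤ⁴`, `0 ≤ β_W ≤ 1/12` (tree coupling `β_W/2`): for EVERY DLR state `μ`, every
  finite site region `Λs`, every link set `Λ` whose plaquettes have their corners in `Λs`, and every closed walk `γ` whose links are at depth
  `≥ D` in `Λ`: `|⟨W_γ⟩^{free}_{Λs} − ⟨W_γ⟩_μ| ≤ 8 · |γ|² · (1/2)^{⌊D⌋}`;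
* ★ `suN_wilson_loop_free_bakryEmery` — every `N ≥ 2`, every `d ≥ 1`, Bakry–Émery window (`2(d−1)|β| < 1/2`, 't Hooft `β`, tree `Nβ`):
  `|⟨W_γ⟩^{free}_{Λs} − ⟨W_γ⟩_μ| ≤ (2N/(1 − ρ′)) · |γ|² · ρ′^{⌊D⌋}`, `ρ′ = max(ρ,½)`, `ρ ≥ 6(d−1)|β|/(1/2 − 2(d−1)|β|)`.
WHAT THIS IS NOT: lattice strong coupling; nothing about the continuum limit or the Clay Millennium problem.

References: K. Osterwalder, E. Seiler, Ann. Phys. 110 (1978), §2.1; H. Föllmer, LNM 1362 (1988), Ch. I, (2.8); the seat's `FreeBoundaryDecay.lean`,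
`WilsonLoopBoundaryDecay.lean`; rb-p1's `UniformLoopCorrelatorDecay.lean`.
-/

noncomputable section

open MeasureTheory Filter Function ProbabilityTheory Real SimpleGraph
open scoped NNReal
open Literature.Probability.LatticeModels
open Literature.MathematicalPhysics.QuantumLattice
open Literature.MathematicalPhysics.QuantumFieldTheory hiding ZdEdge Site
open Literature.MathematicalPhysics.QuantumFieldTheory (walkEdges card_walkEdges_le_length)

namespace Summit.Ventures.YMGap.RobustBall

variable {d N : ℕ}

/-- Bookkeeping: `A · (|c| √N |γ|) · #(links of γ) · r ≤ A √N |c| · |γ|² · r` for `A, r ≥ 0` (as in `WilsonLoopLocality.loop_constant_le'`,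
restated to keep this file independent of it). [folklore] -/
private theorem loop_constant_le_free (c : ℝ) {x : Literature.Probability.LatticeModels.Site d} (w : (zdGraph d).Walk x x) {A r : ℝ}
    (hA : 0 ≤ A) (hr : 0 ≤ r) :
    A * ((⟨|c| * Real.sqrt N * w.length, by positivity⟩ : ℝ≥0) : ℝ) * (walkEdges w).card * r ≤
      A * Real.sqrt N * |c| * (w.length : ℝ) ^ 2 * r := by
  show A * (|c| * Real.sqrt N * w.length) * (walkEdges w).card * r ≤ _
  have hcard : ((walkEdges w).card : ℝ) ≤ w.length := by exact_mod_cast card_walkEdges_le_length w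
  have h0 : 0 ≤ A * (|c| * Real.sqrt N * w.length) * r := by positivity
  calc A * (|c| * Real.sqrt N * w.length) * (walkEdges w).card * r
      = (A * (|c| * Real.sqrt N * w.length) * r) * (walkEdges w).card := by ring
    _ ≤ (A * (|c| * Real.sqrt N * w.length) * r) * w.length := mul_le_mul_of_nonneg_left hcard h0
    _ = A * Real.sqrt N * |c| * (w.length : ℝ) ^ 2 * r := by ring

/-- ★★ **WILSON LOOPS WITH FREE BOUNDARY CONDITIONS, `SU(2)` on `ℤ⁴`, `0 ≤ β_W ≤ 1/12`** (tree coupling `β_W/2`): for EVERY DLR state `μ`, every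
finite site region `Λs`, every finite link set `Λ` all of whose plaquettes have their corners in `Λs`, and every closed lattice walk `γ` whose links
are at base-point depth `≥ D` in `Λ`: `|∫ W_γ dμ^{free}_{Λs, β_W/2} − ∫ W_γ dμ| ≤ 8 · |γ|² · (1/2)^{⌊D⌋}`. [folklore] -/
theorem su2_wilson_loop_free_upTo_oneTwelfth {βW : ℝ} (h0 : 0 ≤ βW) (h : βW ≤ 1 / 12)
    {μ : Measure (LGConfig 4 (SUN 2))} (hμ : μ ∈ ymGibbsMeasures (d := 4) (fundamentalRep (Fin 2)) (βW / 2))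
    (Λs : Finset (Literature.Probability.LatticeModels.Site 4)) (Λ : Finset (ZdEdge 4))
    (hΛ : ∀ x ∈ Λ, ∀ p ∈ plaquettesTouching {x}, ((p.1, p.2.1.1, p.2.1.2) : Plaq 4) ∈ plaquettesIn Λs)
    {x : Literature.Probability.LatticeModels.Site 4} (w : (zdGraph 4).Walk x x) {D : ℝ}
    (hD : ∀ y ∈ walkEdges w, ∀ z, z ∉ Λ → D ≤ ‖y.1 - z.1‖) :
    |(∫ U, loopTerm 2 1 w U ∂(zdWilsonMeasure (d := 4) (fundamentalRep (Fin 2)) (βW / 2) Λs)) - ∫ U, loopTerm 2 1 w U ∂μ| ≤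
      8 * (w.length : ℝ) ^ 2 * (1 / 2 : ℝ) ^ ⌊D⌋₊ := by
  have h1 := su2_wilson_free_upTo_oneTwelfth h0 h hμ Λs Λ hΛ (isLipschitzCylinder_loopTerm (N := 2) 1 w) hD
  have hr : 0 ≤ (1 / 2 : ℝ) ^ ⌊D⌋₊ := pow_nonneg (by norm_num) _
  refine (h1.trans (loop_constant_le_free (N := 2) 1 w (by positivity) hr)).trans (le_of_eq ?_)
  have hsq : Real.sqrt 2 * Real.sqrt ((2 : ℕ) : ℝ) = 2 := by
    rw [show ((2 : ℕ) : ℝ) = 2 by norm_num]; exact Real.mul_self_sqrt (by norm_num)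
  rw [abs_one]
  calc 4 * Real.sqrt 2 * Real.sqrt ((2 : ℕ) : ℝ) * 1 * (w.length : ℝ) ^ 2 * (1 / 2 : ℝ) ^ ⌊D⌋₊
      = 4 * (Real.sqrt 2 * Real.sqrt ((2 : ℕ) : ℝ)) * (w.length : ℝ) ^ 2 * (1 / 2 : ℝ) ^ ⌊D⌋₊ := by ring
    _ = 8 * (w.length : ℝ) ^ 2 * (1 / 2 : ℝ) ^ ⌊D⌋₊ := by rw [hsq]; ring

/-- ★ **WILSON LOOPS WITH FREE BOUNDARY CONDITIONS, EVERY `N ≥ 2`, EVERY `d ≥ 1`** (Bakry–Émery window `2(d−1)|β| < 1/2`, 't Hooft `β`, tree coupling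
`Nβ`; `ρ ≥ 6(d−1)|β|/(1/2 − 2(d−1)|β|)`, `ρ < 1`, `ρ′ = max(ρ,½)`): `|∫ W_γ dμ^{free}_{Λs, Nβ} − ∫ W_γ dμ| ≤ (2N/(1 − ρ′)) · |γ|² · ρ′^{⌊D⌋}`. [folklore] -/
theorem suN_wilson_loop_free_bakryEmery (hd : 1 ≤ d) (hN : 2 ≤ N) {β ρ : ℝ} (hb : |β| * (2 * ((d : ℝ) - 1)) < 1 / 2)
    (hρ : 6 * ((d : ℝ) - 1) * |β| / (1 / 2 - |β| * (2 * ((d : ℝ) - 1))) ≤ ρ) (hρ1 : ρ < 1)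
    {μ : Measure (LGConfig d (SUN N))} (hμ : μ ∈ ymGibbsMeasures (d := d) (fundamentalRep (Fin N)) (N * β))
    (Λs : Finset (Literature.Probability.LatticeModels.Site d)) (Λ : Finset (ZdEdge d))
    (hΛ : ∀ x ∈ Λ, ∀ p ∈ plaquettesTouching {x}, ((p.1, p.2.1.1, p.2.1.2) : Plaq d) ∈ plaquettesIn Λs)
    {x : Literature.Probability.LatticeModels.Site d} (w : (zdGraph d).Walk x x) {D : ℝ}
    (hD : ∀ y ∈ walkEdges w, ∀ z, z ∉ Λ → D ≤ ‖y.1 - z.1‖) :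
    |(∫ U, loopTerm N 1 w U ∂(zdWilsonMeasure (d := d) (fundamentalRep (Fin N)) (N * β) Λs)) - ∫ U, loopTerm N 1 w U ∂μ| ≤
      2 * N / (1 - max ρ (1 / 2)) * (w.length : ℝ) ^ 2 * (max ρ (1 / 2)) ^ ⌊D⌋₊ := by
  have h1 := suN_wilson_free_bakryEmery hd hN hb hρ hρ1 hμ Λs Λ hΛ (isLipschitzCylinder_loopTerm (N := N) 1 w) hD
  have hc'1 : max ρ (1 / 2) < 1 := max_lt hρ1 (by norm_num)
  have h1ρ : 0 < 1 - max ρ (1 / 2) := by linarith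
  have hr : 0 ≤ (max ρ (1 / 2)) ^ ⌊D⌋₊ := pow_nonneg (le_max_of_le_right (by norm_num)) _
  have hA : 0 ≤ 2 * Real.sqrt N / (1 - max ρ (1 / 2)) := div_nonneg (by positivity) h1ρ.le
  refine (h1.trans (loop_constant_le_free (N := N) 1 w hA hr)).trans (le_of_eq ?_)
  have hsq : Real.sqrt N * Real.sqrt N = N := Real.mul_self_sqrt (Nat.cast_nonneg N)
  rw [abs_one]
  calc 2 * Real.sqrt N / (1 - max ρ (1 / 2)) * Real.sqrt N * 1 * (w.length : ℝ) ^ 2 * (max ρ (1 / 2)) ^ ⌊D⌋₊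
      = 2 * (Real.sqrt N * Real.sqrt N) / (1 - max ρ (1 / 2)) * (w.length : ℝ) ^ 2 * (max ρ (1 / 2)) ^ ⌊D⌋₊ := by ring
    _ = 2 * N / (1 - max ρ (1 / 2)) * (w.length : ℝ) ^ 2 * (max ρ (1 / 2)) ^ ⌊D⌋₊ := by rw [hsq]

end Summit.Ventures.YMGap.RobustBall

end
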